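import Mathlib
import HarnessLib
import Summits.QuantumFields.YangMills.Theses.ScalingWindowSplit
import Summits.QuantumFields.YangMills.Theorems.ConvexGribovBodyNonSimplyConnectedLatticeGapAdmissibleInstance
import Literature.MathematicalPhysics.QuantumFieldTheory.LatticeGaugeProofs

/-!
# `GapAtCorrelationLength` (stmt-QuantumFields-18927) — negative lemma: a LIGHT-FLUX GROUP refutes W₁ as typed

Negative lemma (line lead, crux `ScalingWindowSplit.GapAtCorrelationLength` = W₁ of route `ScalingWindowSplit`;
it lands, in the weakest hypothesis the bookkeeping needs, the obstruction found by the crux strategist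
(`Cruxes/GapAtCorrelationLength/LightFluxObstruction.lean`, `STRATEGY-CENSUS.md` §1) and sharpened by ideator 1
(`Cruxes/GapAtCorrelationLength/NegationIdeator1.lean`)).

**Finding.**  W₁ is `∀ G` compact simple (`IsCompactSimpleLieGroup G`: connected, non-abelian, simplicity clause,
a faithful unitary representation — `SO(3)` qualifies, `isCompactSimpleLieGroup_SO3` is landed) `∃ r sch … `, and its
fifth conjunct — the inlined RP-spectral clause (b) — quantifies over ALL bounded measurable functionals `Y` of the
lattice gauge field whose support lies in a TIME slab `[1, T₀]`, with NO spatial restriction, `Y` being chosen after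
the torus side `2S₀+1 ≥ 2L_k+1`:
`|⟨ΘY · τ_nY⟩ − ⟨Y⟩²| ≤ e^{−Δ a_k n} (⟨ΘY · Y⟩ − ⟨Y⟩²) + C B² e^{−Δ a_k S₀}`.
For such global `Y` this is the `S₀`-uniform spectral gap `Δ a_k` of the FULL torus transfer matrix, flux sectors
included.  Consequently (`gapAtCorrelationLength_false_of_lightFluxMode`, pure bookkeeping): if an admissible `G`
carries, for every faithful `r` and at every large coupling, on arbitrarily large odd tori a bounded slab functional
whose reflected time-`n` covariance at a separation `n ≥ S₀/4` is at least `e^{−ε S₀}` for EVERY prescribed rate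
`ε > 0` (`LightFluxMode G`), then W₁ is false.  Packaged: `LightFluxGroup → ¬ GapAtCorrelationLength`
(`GapAtCorrelationLength_false_of_LightFluxGroup`), and `LightFluxMode SO(3)` alone already refutes W₁
(`gapAtCorrelationLength_false_of_lightFluxMode_SO3`, `lightFluxGroup_of_SO3`).

**Why `H` is expected (physics) and why it is not constructible here.**  For a centre-free group such as
`G = SO(3) = SU(2)/ℤ₂` write the theory with `SU(2)` link variables `Ũ` and a sign-blind action (exact Haar
push-forward).  For the spatial 2-torus `Σ` = the `(1,2)`-plane at fixed `(x₀, x₃)` the product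
`η_Σ := ∏_{p ∈ Σ} sign tr_F Ũ_p` is lift-independent (every link of `Σ` lies in two plaquettes of `Σ`), bounded,
measurable, gauge-invariant and supported in ONE time slice — an admissible `Y` (de Forcrand–Jahn 2003, key
`DeforcrandJahn2003`, §4: "a proper SO(3) observable … measures the ℤ₂ flux through the μν-plane").  Exactly,
`η_{Σ,t} η_{Σ,t'} = (−1)^{#ℤ₂-monopole world-lines crossing Σ × [t,t']}`; a monopole cube forces a face with
`SO(3)` plaquette angle `≥ π/3` (Bianchi identity in `SU(2)`), hence costs `≥ c_r β`, so at weak coupling the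
monopole current is a Peierls-dilute gas of small closed loops, and the DISC-REPAIRED flux
`η̃_t := η_{Σ,t} · (−1)^{(canonical local filling of the small clusters) · Σ_t}` is a slab functional of width
`T ≍ (log S₀)/β` with `⟨Θη̃ · τ_n η̃⟩ ≥ 1 − o(1)` for all `n ≤ S₀/2 − T − 1` (near-conservation in Euclidean time)
and `⟨η̃⟩ = w₊ − w₋`, the difference of the weights of the two magnetic-flux sectors, so that the covariance is
`≈ 4 w₊ w₋`.  `LightFluxMode SO(3)` thus says `min(w₊, w₋)(S₀; β) ≥ e^{−o(S₀)}` on large symmetric tori at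
every large `β`: NO MAGNETIC MEISSNER EFFECT.  In the confined phase 't Hooft's magnetic flux is LIGHT,
`w₋/w₊ → 1` ('t Hooft 1979, key `tHooft1979Flux`; rigorous flux formalism and tension inequalities Borgs–Seiler
1983, key `BorgsSeiler1983`, §II; numerically Kovács–Tomboulis 2000, de Forcrand–Jahn 2003 §6), and in a Coulomb
phase `w₋/w₊ → const > 0`; `H` fails only in a magnetic-Higgs phase with a LINEAR magnetic-flux tension, which is
what W₁ as typed asserts for every non-simply-connected compact simple `G`.  Neither face is a theorem today:
lower bounds on twisted-sector weights by Jensen / thick classical vortices give only `e^{−c β S₀²}`, reflection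
positivity gives only upper bounds on defect partition functions, and the chessboard Peierls estimate for the
monopole gas is elementary but unformalised — `H` is a construction item, not a Literature fact.

**Repair proposed to the planner (class, on paper: misstated — over-quantified functional class).**
`C′`: in conjunct (b) quantify `Y` over the LOCAL class only — either R1: add `∀ i ≠ 0, |e.1 i| ≤ R` with `R < S₀`
to the `DependsOn` set (typed seed `Strategist.slabBox`, `Strategist.OneScaleRPCoreLoc`), or R2: finite sums of finite
products of bounded gauge-invariant functionals each supported in (time slab) ∩ (a spatial cube of side `< 2S₀+1`);
or split W₁ by `π₁(G)` (typed W₁ for simply-connected `G`, local core for the rest).  Every landed consumer of (b)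
(`stub_gapOfRPSpectral` p142771, `stub_mirrorOfRPSpectral`, `PeelDecayOfSlabClustering`, the glue
`existenceLegFromLattice_proof`) instantiates `Y` in the local class, and the witness `η̃` is not in it (flat
twist-eaters and the trivial configuration agree on every contractible patch).  The witness misses `C′`.

Contents: `LightFluxMode` (parametric hypothesis, weakest form), `gapAtCorrelationLength_false_of_lightFluxMode`
(`IsCompactSimpleLieGroup G → LightFluxMode G → ¬W₁`), `LightFluxGroup` (`H`),
`GapAtCorrelationLength_false_of_LightFluxGroup` (`H → ¬W₁`), the `SO(3)` specialisations.  No `sorry`;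
axioms `propext`, `Classical.choice`, `Quot.sound`.  Relations: `Strategist.LightFlux G → LightFluxMode G` and
`Ideator1.LightFluxWeak G → LightFluxMode G` (take `ε/2` there and `S₀ ≥ (2/ε) log (4/3)`); not restated here.
-/

noncomputable section

open scoped BigOperators Topology
open MeasureTheory Filter Set Function
open Literature.MathematicalPhysics.QuantumLattice Literature.MathematicalPhysics.AQFT
open Literature.MathematicalPhysics.QuantumFieldTheory
open Literature.AlgebraicTopology.FundamentalGroup (SO3)
open Summit.QuantumFields.YangMills.Theorems.NonSimplyConnectedLatticeGap
  (so3_isTopologicalGroup so3_compactSpace isCompactSimpleLieGroup_SO3)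

namespace Summit.QuantumFields.YangMills.Theorems.GapAtCorrelationLength.Negative

open Summit.QuantumFields.YangMills.Theses.ScalingWindowSplit (GapAtCorrelationLength)

/-- **Light-flux mode of the gauge group `G`** (parametric hypothesis of the negative lemma, in the weakest form the
bookkeeping uses).  For every faithful lattice representation `r` of `G`, at every sufficiently large inverse coupling
`β`, for every rate `ε > 0` and beyond every size `M₀` there are an odd torus `(2S+1)⁴` with `S ≥ M₀`, a time slab
`[1, T]` and a separation `n` with `2(T+n+1) ≤ S ≤ 4n`, and a measurable functional `Y` of the lattice gauge field,
`|Y| ≤ 1`, depending only on the edges of the slab (exactly the support class of W₁'s RP-spectral conjunct), whose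
reflected time-`n` covariance under Wilson's measure `wilsonMeasure r.ρ β` on that torus is at least `e^{−ε S}`:
`e^{−εS} ≤ ⟨ΘY · τ_n Y⟩ − ⟨Y⟩²` (integrals verbatim as in the crux).  For `G = SO(3)`: the disc-repaired ℤ₂ magnetic
flux through a spatial 2-torus, populated in both sectors with subexponential minority weight ("no magnetic Meissner
effect"; 't Hooft's light flux in the confined phase gives covariance `→ 1`).  Physics-certain, rigorously open.
[folklore] -/
def LightFluxMode (G : Type) [Group G] [TopologicalSpace G] [IsTopologicalGroup G] [CompactSpace G] : Prop :=
  letI : MeasurableSpace G := borel G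
  haveI : BorelSpace G := ⟨rfl⟩
  ∀ (r : LatticeRep G), ∀ᶠ β : ℝ in atTop, ∀ ε : ℝ, 0 < ε → ∀ M₀ : ℕ,
    ∃ (S T n : ℕ), M₀ ≤ S ∧ 2 * (T + n + 1) ≤ S ∧ S ≤ 4 * n ∧
    ∃ (Y : LGConfig 4 G → ℝ), Measurable Y ∧ (∀ U, |Y U| ≤ 1) ∧
      DependsOn Y {e : Literature.MathematicalPhysics.QuantumLattice.ZdEdge 4 |
        1 ≤ e.1 0 ∧ e.1 0 + (if e.2 = 0 then 1 else 0) ≤ T} ∧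
      Real.exp (-(ε * S)) ≤
        (∫ U, Y (torusLift (2 * S + 1) (GaugeConfig.timeReflect U)) *
            Y (configShift (-Pi.single 0 (n : ℤ)) (torusLift (2 * S + 1) U))
            ∂(wilsonMeasure r.ρ β : Measure (GaugeConfig 4 (2 * S + 1) G))) -
        (∫ U, Y (torusLift (2 * S + 1) U)
            ∂(wilsonMeasure r.ρ β : Measure (GaugeConfig 4 (2 * S + 1) G))) ^ 2

/-- **An admissible gauge group with a light-flux mode refutes W₁** (`IsCompactSimpleLieGroup G → LightFluxMode G →
¬ GapAtCorrelationLength`).  Bookkeeping: W₁ at `G` gives `(r, sch, Δ, C, …)` with `β_k → ∞` and the RP-spectral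
clause eventually; at a step `k` where the clause is active and `β_k` is large take `ε := Δ a_k / 8` and the witness
`(S, T, n, Y)` of `H` on a torus `S ≥ L_k`; the clause at `(S, T, n, Y, B = 1)` bounds the covariance by
`e^{−Δ a_k n}(⟨ΘY·Y⟩ − ⟨Y⟩²) + C e^{−Δ a_k S} ≤ e^{−Δ a_k S/4} + |C| e^{−Δ a_k S}
= e^{−εS}(e^{−Δ a_k S/8} + |C| e^{−7Δ a_k S/8}) < e^{−εS}` for large `S` (here `⟨ΘY·Y⟩ ≤ 1` because `|Y| ≤ 1` and
Wilson's measure is a probability measure), contradicting `e^{−εS} ≤` covariance. [folklore] -/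
theorem gapAtCorrelationLength_false_of_lightFluxMode
    (G : Type) [Group G] [TopologicalSpace G] [IsTopologicalGroup G] [CompactSpace G]
    (hG : IsCompactSimpleLieGroup G) (hH : LightFluxMode G) :
    ¬ GapAtCorrelationLength := by
  intro hW
  letI : MeasurableSpace G := borel G
  haveI : BorelSpace G := ⟨rfl⟩
  obtain ⟨r, sch, u, p, M, Δ, C, hweak, hvol, hΔ, hgap, hRP, hsupp, hfw⟩ := hW G hG
  -- a step `k` at which the RP-spectral clause is active and the coupling is in the light-flux regime
  obtain ⟨k, hRPk, hβk⟩ := (hRP.and (hweak.eventually (hH r))).exists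
  have ha : 0 < sch.a k := sch.a_pos k
  have hΔa : 0 < Δ * sch.a k := mul_pos hΔ ha
  -- the rate of the witness: ε := Δ a_k / 8
  set ε : ℝ := Δ * sch.a k / 8 with hε_def
  have hε : 0 < ε := by positivity
  -- h(S) := e^{-Δ a S/8} + |C| e^{-7 Δ a S/8} → 0
  set h : ℝ → ℝ := fun x =>
      Real.exp (-(Δ * sch.a k * x / 8)) + |C| * Real.exp (-(7 * (Δ * sch.a k) * x / 8)) with hh_def
  have hh : Tendsto h atTop (𝓝 0) := by
    have h1 : Tendsto (fun x : ℝ => Δ * sch.a k * x / 8) atTop atTop :=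
      (tendsto_id.const_mul_atTop hΔa).atTop_div_const (by norm_num)
    have h7 : Tendsto (fun x : ℝ => 7 * (Δ * sch.a k) * x / 8) atTop atTop :=
      (tendsto_id.const_mul_atTop (by positivity : (0:ℝ) < 7 * (Δ * sch.a k))).atTop_div_const
        (by norm_num)
    have e1 : Tendsto (fun x : ℝ => Real.exp (-(Δ * sch.a k * x / 8))) atTop (𝓝 0) :=
      Real.tendsto_exp_atBot.comp (tendsto_neg_atTop_atBot.comp h1)
    have e2 : Tendsto (fun x : ℝ => |C| * Real.exp (-(7 * (Δ * sch.a k) * x / 8))) atTop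
        (𝓝 (|C| * 0)) :=
      (Real.tendsto_exp_atBot.comp (tendsto_neg_atTop_atBot.comp h7)).const_mul |C|
    simpa [hh_def] using e1.add e2
  have hhN : Tendsto (fun S : ℕ => h S) atTop (𝓝 0) := hh.comp tendsto_natCast_atTop_atTop
  obtain ⟨N₀, hN₀⟩ := eventually_atTop.1 (hhN.eventually (gt_mem_nhds (by norm_num : (0:ℝ) < 1)))
  -- the witness on a torus beyond `max N₀ L_k`
  obtain ⟨S, T, n, hMS, h2, h4, Y, hYm, hYb, hYdep, hcov⟩ := hβk ε hε (max N₀ (sch.L k))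
  have hLS : sch.L k ≤ S := (le_max_right _ _).trans hMS
  have hNS : N₀ ≤ S := (le_max_left _ _).trans hMS
  have key := hRPk S T n hLS h2 Y 1 hYm hYb hYdep
  -- `⟨ΘY · Y⟩ ≤ 1`: `|Y| ≤ 1` under a probability measure
  haveI : IsProbabilityMeasure (wilsonMeasure (d := 4) (L := 2 * S + 1) (G := G) r.ρ (sch.β k)) :=
    isProbabilityMeasure_wilsonMeasure r.ρ r.continuous _
  have hI0 : (∫ U, Y (torusLift (2 * S + 1) (GaugeConfig.timeReflect U)) * Y (torusLift (2 * S + 1) U)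
      ∂(wilsonMeasure r.ρ (sch.β k) : Measure (GaugeConfig 4 (2 * S + 1) G))) ≤ 1 := by
    have hb : ∀ U : GaugeConfig 4 (2 * S + 1) G,
        ‖Y (torusLift (2 * S + 1) (GaugeConfig.timeReflect U)) * Y (torusLift (2 * S + 1) U)‖ ≤ 1 := by
      intro U
      rw [Real.norm_eq_abs, abs_mul]
      have h1 := hYb (torusLift (2 * S + 1) (GaugeConfig.timeReflect U))
      have h2 := hYb (torusLift (2 * S + 1) U)
      have h3 := abs_nonneg (Y (torusLift (2 * S + 1) (GaugeConfig.timeReflect U)))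
      nlinarith
    have hint := norm_integral_le_of_norm_le_const
      (μ := (wilsonMeasure r.ρ (sch.β k) : Measure (GaugeConfig 4 (2 * S + 1) G)))
      (Eventually.of_forall hb)
    simp only [probReal_univ, mul_one, Real.norm_eq_abs] at hint
    exact (le_abs_self _).trans hint
  generalize hIn_def : (∫ U, Y (torusLift (2 * S + 1) (GaugeConfig.timeReflect U)) *
      Y (configShift (-Pi.single 0 (n : ℤ)) (torusLift (2 * S + 1) U))
      ∂(wilsonMeasure r.ρ (sch.β k) : Measure (GaugeConfig 4 (2 * S + 1) G))) = In at key hcov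
  generalize hI0_def : (∫ U, Y (torusLift (2 * S + 1) (GaugeConfig.timeReflect U)) *
      Y (torusLift (2 * S + 1) U)
      ∂(wilsonMeasure r.ρ (sch.β k) : Measure (GaugeConfig 4 (2 * S + 1) G))) = I0 at key hI0
  generalize hm_def : (∫ U, Y (torusLift (2 * S + 1) U)
      ∂(wilsonMeasure r.ρ (sch.β k) : Measure (GaugeConfig 4 (2 * S + 1) G))) = m at key hcov
  -- exponent algebra: e^{-Δ a n} ≤ e^{-Δ a S/4} = e^{-εS} e^{-Δ a S/8},  e^{-Δ a S} = e^{-εS} e^{-7Δ a S/8}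
  have hS4 : (S : ℝ) ≤ 4 * n := by exact_mod_cast h4
  have hexp_n : Real.exp (-(Δ * sch.a k * n)) ≤ Real.exp (-(Δ * sch.a k * S / 4)) := by
    apply Real.exp_le_exp.2
    nlinarith [mul_le_mul_of_nonneg_left hS4 hΔa.le]
  have hsplit4 : Real.exp (-(Δ * sch.a k * S / 4)) =
      Real.exp (-(ε * S)) * Real.exp (-(Δ * sch.a k * S / 8)) := by
    rw [← Real.exp_add, hε_def]; ring_nf
  have hsplit1 : Real.exp (-(Δ * sch.a k * S)) =
      Real.exp (-(ε * S)) * Real.exp (-(7 * (Δ * sch.a k) * S / 8)) := by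
    rw [← Real.exp_add, hε_def]; ring_nf
  have hE : 0 < Real.exp (-(ε * S)) := Real.exp_pos _
  have hexp0 : 0 ≤ Real.exp (-(Δ * sch.a k * n)) := Real.exp_nonneg _
  have hdiff : I0 - m ^ 2 ≤ 1 := by nlinarith [sq_nonneg m]
  -- upper bound from the clause
  have hup : In - m ^ 2 ≤ Real.exp (-(ε * S)) * h S := by
    have t1 : Real.exp (-(Δ * sch.a k * n)) * (I0 - m ^ 2) ≤
        Real.exp (-(ε * S)) * Real.exp (-(Δ * sch.a k * S / 8)) := by
      calc Real.exp (-(Δ * sch.a k * n)) * (I0 - m ^ 2)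
          ≤ Real.exp (-(Δ * sch.a k * n)) * 1 := mul_le_mul_of_nonneg_left hdiff hexp0
        _ ≤ Real.exp (-(Δ * sch.a k * S / 4)) := by simpa using hexp_n
        _ = _ := hsplit4
    have t2 : C * (1 : ℝ) ^ 2 * Real.exp (-(Δ * sch.a k * S)) ≤
        Real.exp (-(ε * S)) * (|C| * Real.exp (-(7 * (Δ * sch.a k) * S / 8))) := by
      rw [hsplit1]
      have hC := le_abs_self C
      have hE7 : 0 ≤ Real.exp (-(7 * (Δ * sch.a k) * S / 8)) := Real.exp_nonneg _
      nlinarith [mul_nonneg hE.le hE7]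
    have hlhs : In - m ^ 2 ≤ |In - m ^ 2| := le_abs_self _
    have : In - m ^ 2 ≤ Real.exp (-(ε * S)) * Real.exp (-(Δ * sch.a k * S / 8)) +
        Real.exp (-(ε * S)) * (|C| * Real.exp (-(7 * (Δ * sch.a k) * S / 8))) := by linarith
    simpa [hh_def, mul_add] using this
  -- lower bound from the witness and the contradiction `e^{-εS} ≤ In - m² ≤ e^{-εS} h S < e^{-εS}`
  have hhS : h S < 1 := hN₀ S hNS
  have : Real.exp (-(ε * S)) * h S < Real.exp (-(ε * S)) * 1 := mul_lt_mul_of_pos_left hhS hE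
  linarith

/-- **`H` — a LIGHT-FLUX GROUP** (hypothesis of the negative lemma; not constructible in the tree): some compact simple
Lie group in the crux's sense (`IsCompactSimpleLieGroup`: connected, non-abelian, simplicity clause, a faithful unitary
representation) carries a light-flux mode (`LightFluxMode`).  Intended inhabitant: `G = SO(3)` (admissible by the landed
`isCompactSimpleLieGroup_SO3`; `lightFluxGroup_of_SO3`) with the disc-repaired ℤ₂ magnetic flux through a spatial
2-torus — 't Hooft's light magnetic flux / absence of a magnetic Meissner effect at weak coupling, physics-certain and
rigorously open (needs a chessboard Peierls bound for the ℤ₂-monopole gas and a subexponential lower bound on the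
minority twist-sector weight on symmetric tori). [folklore] -/
def LightFluxGroup : Prop :=
  ∃ (G : Type) (_ : Group G) (_ : TopologicalSpace G) (_ : IsTopologicalGroup G) (_ : CompactSpace G),
    IsCompactSimpleLieGroup G ∧ LightFluxMode G

/-- **Negative lemma modulo `H`: a light-flux group refutes W₁ as typed.**
`LightFluxGroup → ¬ GapAtCorrelationLength`.  Class (on paper): refuted-misstated — the RP-spectral conjunct of W₁
quantifies over spatially GLOBAL slab functionals; the repaired statement `C′` restricts `Y` to the local class
(spatial box of half-side `R < S₀`, or the local gauge-invariant algebra), which every landed consumer uses and which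
the flux witness behind `H` does not meet. [folklore] -/
theorem GapAtCorrelationLength_false_of_LightFluxGroup :
    LightFluxGroup → ¬ GapAtCorrelationLength := by
  rintro ⟨G, _, _, _, _, hG, hH⟩
  exact gapAtCorrelationLength_false_of_lightFluxMode G hG hH

/-- **`SO(3)` specialisation**: a light-flux mode of `SO(3)` (with the landed instances `so3_isTopologicalGroup`,
`so3_compactSpace`) alone refutes W₁, `SO(3)` being admissible (`isCompactSimpleLieGroup_SO3`). [folklore] -/
theorem gapAtCorrelationLength_false_of_lightFluxMode_SO3
    (hH : @LightFluxMode SO3 _ _ so3_isTopologicalGroup so3_compactSpace) :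
    ¬ GapAtCorrelationLength :=
  @gapAtCorrelationLength_false_of_lightFluxMode SO3 _ _ so3_isTopologicalGroup so3_compactSpace
    isCompactSimpleLieGroup_SO3 hH

/-- `H` is inhabited by `SO(3)` as soon as `SO(3)` has a light-flux mode (the intended construction). [folklore] -/
theorem lightFluxGroup_of_SO3 (hH : @LightFluxMode SO3 _ _ so3_isTopologicalGroup so3_compactSpace) :
    LightFluxGroup :=
  ⟨SO3, inferInstance, inferInstance, so3_isTopologicalGroup, so3_compactSpace, isCompactSimpleLieGroup_SO3, hH⟩

end Summit.QuantumFields.YangMills.Theorems.GapAtCorrelationLength.Negative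

end
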